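import Literature.Probability.FitznerVanDerHofstad2017.WeightSplitCrossTerm
import HarnessLib

/-!
# The block drift identities behind the diagram-level weight split "LEMMA J" (cell pub-lace7, Lean seat 3; layer A)

PROGRAMME-INTERNAL (no printed counterpart; NOT CITABLE as literature).  Companion of the tree module
`Literature/Probability/FitznerVanDerHofstad2017/WeightSplitCrossTerm.lean` (the arithmetic kernel (K) of the `b2b-lace`
packet's LEMMA J, `carver/g8/LEMMA-J.md`).  Context: [FvdH17]-ext proof of Lemma `lemmapercboundXi1`, display (BoundNOne):
"`‖x‖₂² ≤ 3(‖w‖₂² + ‖z−w‖₂² + ‖x−z‖₂²)`" — the Cauchy–Schwarz factor `J = 3` of the `N = 1` weighted bound; LEMMA J Thm 3: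
at DIAGRAM level the factor is `1`, because the conditional drifts of the three backbone pieces do not align.

This file proves the three BLOCK DRIFT facts that feed LEMMA J Thm 1/Thm 3 (the chain identity and the `N = 1` sign theorem),
stated over abstract block weights on `ℤ^d` (`Fin d → ℤ`), `d`-generic, with `tsum`s over `ℤ^d` (no summability is needed for
the vanishing identities — a non-summable `tsum` is `0` on both sides):

* `tsum_twoMul_add_shift_eq_zero` (TRIANGLE / EQUAL-RAIL DRIFT, LEMMA-J Thm 2 proof): for an EVEN weight `g` and any `r ∈ ℤ^d`,
  `Σ'_w (2 w_i + r_i) · g(w + r) g(w) = 0` — the involution `w ↦ −w − r`; hence, when the two sums exist,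
  `Σ'_w w_i g(w + r) g(w) = −(r_i/2) Σ'_w g(w + r) g(w)` (`tsum_coord_mul_shift_eq`): "the conditional mean of the backbone leg of a
  triangle with exchangeable legs, given the rung `r`, is `−r/2`"; the same identity read with `a = b + q` is the square statement
  "`E[a + b | a − b = q] = 0`" for equal even rails.
* `sq_sum_drift_le` (BOND DRIFT, LEMMA-J Thm 3 (i)): for non-negative weights `λ_e` on a finite set `E` of lattice vectors of Euclidean
  length `≤ 1` (the pivotal bond summed over its directions, with or without a no-step atom),
  `Σ_i (Σ_{e∈E} λ_e e_i)² ≤ (Σ_{e∈E} λ_e)²` — the drift `m = (Σ λ_e e)/(Σ λ_e)` has `|m| ≤ 1`, which is the hypothesis `hm` of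
  `WeightSplitCrossTerm.crossKernel`.
* `crossKernel_of_drift` — (K) in the un-normalised form the assembly uses: `½ Σ_i N_i s_i ≤ ¼ W (|r₀|² + |r₁|² + |s|²)` whenever
  `Σ N_i² ≤ W²`, `0 ≤ W`, `s = r₁ − r₀`.

HONEST FRAMING: elementary algebra; no percolation object occurs; nothing here is a claim about any dimension.  The diagram-level
assembly (LEMMA-J Thm 1 for three blocks + Thm 3 (i): `Σ‖x‖²F ≤ Σ_k Σ‖Δ_k‖²F`) is the next layer and is NOT in this file.
-/

noncomputable section

namespace Summit.CriticalPhenomena.LaceExpansionHighD.WeightSplit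

open Finset
open scoped BigOperators

variable {d : ℕ}

/-! Evenness of a weight on `ℤ^d` is Mathlib's `Function.Even g : ∀ x, g (−x) = g x` (two-point functions, their
length-restricted versions `τ_{≥n}` and the non-backtracking majorants are even). -/

/-! ## 1. The triangle / equal-rail drift -/

/-- **Triangle drift, vanishing form.** For an even weight `g` and a rung vector `r`, coordinate by coordinate,
`Σ'_w (2 w_i + r_i) g(w + r) g(w) = 0`: the involution `w ↦ −r − w` reverses the sign of the summand.  No summability
hypothesis (both sides are the same possibly-junk `tsum`). -/
theorem tsum_twoMul_add_shift_eq_zero (g : (Fin d → ℤ) → ℝ) (hg : Function.Even g) (r : Fin d → ℤ) (i : Fin d) :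
    ∑' w : Fin d → ℤ, ((2 * w i + r i : ℤ) : ℝ) * (g (w + r) * g w) = 0 := by
  set φ : (Fin d → ℤ) → ℝ := fun w => ((2 * w i + r i : ℤ) : ℝ) * (g (w + r) * g w) with hφ
  have hneg : ∀ w, φ (-r - w) = -φ w := by
    intro w
    have h1 : -r - w + r = -w := by abel
    have h2 : g (-r - w) = g (w + r) := by
      rw [show -r - w = -(w + r) by abel, hg]
    simp only [hφ, h1, hg w, h2, Pi.sub_apply, Pi.neg_apply]
    push_cast
    ring
  have hre : ∑' w, φ ((Equiv.subLeft (-r)) w) = ∑' w, φ w := (Equiv.subLeft (-r)).tsum_eq φ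
  have hre' : ∑' w, φ ((Equiv.subLeft (-r)) w) = -∑' w, φ w := by
    simp only [Equiv.subLeft_apply, hneg, tsum_neg]
  have : ∑' w, φ w = 0 := by linarith
  simpa [hφ] using this

/-- **Triangle drift, conditional-mean form.** For an even weight `g`, a rung vector `r` and a coordinate `i`, if the two series
exist then `Σ'_w w_i g(w + r) g(w) = −(r_i/2) · Σ'_w g(w + r) g(w)` — "`E[w | r] = −r/2`" for the backbone leg `w` of a triangle
`(0, u = w + r, w)` with exchangeable legs `g(u)`, `g(w)` and ARBITRARY rung weight (the rung weight is constant given `r`).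
Read with `w ↦ b`, `r ↦ q`, `u ↦ a = b + q` it is the equal-rail square statement `E[a + b | a − b = q] = 0`. -/
theorem tsum_coord_mul_shift_eq (g : (Fin d → ℤ) → ℝ) (hg : Function.Even g) (r : Fin d → ℤ) (i : Fin d)
    (h₁ : Summable fun w : Fin d → ℤ => (w i : ℝ) * (g (w + r) * g w))
    (h₀ : Summable fun w : Fin d → ℤ => g (w + r) * g w) :
    ∑' w : Fin d → ℤ, (w i : ℝ) * (g (w + r) * g w) = -((r i : ℝ) / 2) * ∑' w : Fin d → ℤ, g (w + r) * g w := by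
  have h := tsum_twoMul_add_shift_eq_zero g hg r i
  have hsplit : ∑' w : Fin d → ℤ, ((2 * w i + r i : ℤ) : ℝ) * (g (w + r) * g w)
      = 2 * ∑' w : Fin d → ℤ, (w i : ℝ) * (g (w + r) * g w) + (r i : ℝ) * ∑' w : Fin d → ℤ, g (w + r) * g w := by
    rw [← tsum_mul_left, ← tsum_mul_left, ← (h₁.mul_left 2).tsum_add (h₀.mul_left _)]
    congr 1
    ext w
    push_cast
    ring
  rw [hsplit] at h
  linarith

/-! ## 2. The bond drift -/

/-- **Bond drift.** For non-negative weights `λ_e` on a finite set `E ⊆ ℤ^d` of vectors of Euclidean length at most `1`,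
`Σ_i (Σ_{e∈E} λ_e e_i)² ≤ (Σ_{e∈E} λ_e)²` (convexity of the norm: `‖Σ λ_e e‖ ≤ Σ λ_e ‖e‖ ≤ Σ λ_e`).  For the pivotal bond of the
`N = 1` diagram `E = {±e_μ}` (or with the no-step atom `0`), so the conditional drift of the bond given the rung data has length `≤ 1`. -/
theorem sq_sum_drift_le (E : Finset (Fin d → ℤ)) (hE : ∀ e ∈ E, ∑ i, ((e i : ℤ) : ℝ) ^ 2 ≤ 1) (lam : (Fin d → ℤ) → ℝ)
    (hlam : ∀ e ∈ E, 0 ≤ lam e) :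
    ∑ i, (∑ e ∈ E, lam e * (e i : ℝ)) ^ 2 ≤ (∑ e ∈ E, lam e) ^ 2 := by
  -- Euclidean vectors `v e := (e_i)_i` of norm ≤ 1
  let v : (Fin d → ℤ) → EuclideanSpace ℝ (Fin d) := fun e => (WithLp.equiv 2 (Fin d → ℝ)).symm fun i => (e i : ℝ)
  have hv : ∀ e ∈ E, ‖v e‖ ≤ 1 := by
    intro e he
    have hsq : ‖v e‖ ^ 2 ≤ 1 := by
      rw [EuclideanSpace.norm_sq_eq]
      simpa [v, Real.norm_eq_abs, sq_abs] using hE e he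
    nlinarith [norm_nonneg (v e)]
  have hsum : ‖∑ e ∈ E, lam e • v e‖ ≤ ∑ e ∈ E, lam e := by
    refine (norm_sum_le _ _).trans (Finset.sum_le_sum fun e he => ?_)
    rw [norm_smul, Real.norm_of_nonneg (hlam e he)]
    simpa using mul_le_mul_of_nonneg_left (hv e he) (hlam e he)
  have hcoord : ∑ i, (∑ e ∈ E, lam e * (e i : ℝ)) ^ 2 = ‖∑ e ∈ E, lam e • v e‖ ^ 2 := by
    rw [EuclideanSpace.norm_sq_eq]
    refine Finset.sum_congr rfl fun i _ => ?_
    rw [Real.norm_eq_abs, sq_abs]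
    congr 1
    simp [v, Finset.sum_apply, smul_eq_mul]
  rw [hcoord]
  have h0 : 0 ≤ ∑ e ∈ E, lam e := Finset.sum_nonneg hlam
  nlinarith [norm_nonneg (∑ e ∈ E, lam e • v e)]

/-! ## 3. The kernel (K) in un-normalised form -/

/-- **(K), un-normalised.** If the drift numerator `N` and the mass `W ≥ 0` satisfy `Σ_i N_i² ≤ W²`, then for all rung vectors
`r₀, r₁ ∈ ℤ^d`, `½ Σ_i N_i (r₁ − r₀)_i ≤ ¼ W (|r₀|² + |r₁|² + |r₁ − r₀|²)` — `WeightSplitCrossTerm.crossKernel` applied to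
`m = N/W` (and trivial when `W = 0`).  This is the form in which the `N = 1` cross term is bounded rung configuration by rung
configuration (LEMMA-J (4.1): `cross(M) = W(M)(−¼(|r₀|²+|r₁|²+|s|²)) + ½⟨N(M), s⟩`). -/
theorem crossKernel_of_drift (r₀ r₁ : Fin d → ℤ) (N : Fin d → ℝ) {W : ℝ} (hW : 0 ≤ W)
    (hN : ∑ i, (N i) ^ 2 ≤ W ^ 2) :
    (1 / 2 : ℝ) * ∑ i, N i * ((r₁ i - r₀ i : ℤ) : ℝ)
      ≤ (1 / 4 : ℝ) * W * (∑ i, ((r₀ i : ℝ)) ^ 2 + ∑ i, ((r₁ i : ℝ)) ^ 2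
          + ∑ i, (((r₁ i - r₀ i : ℤ) : ℝ)) ^ 2) := by
  rcases hW.eq_or_lt with hW0 | hWpos
  · -- W = 0 forces N = 0
    have hN0 : ∀ i, N i = 0 := by
      intro i
      have hle : ∑ j, (N j) ^ 2 ≤ 0 := by simpa [← hW0] using hN
      have hge : 0 ≤ ∑ j, (N j) ^ 2 := Finset.sum_nonneg fun j _ => sq_nonneg (N j)
      have hz : ∑ j, (N j) ^ 2 = 0 := le_antisymm hle hge
      have := (Finset.sum_eq_zero_iff_of_nonneg fun j _ => sq_nonneg (N j)).1 hz i (Finset.mem_univ i)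
      exact pow_eq_zero_iff (n := 2) (by norm_num) |>.1 this
    simp [hN0, ← hW0]
  · set m : Fin d → ℝ := fun i => N i / W with hm
    have hm1 : ∑ i, (m i) ^ 2 ≤ 1 := by
      have : ∑ i, (m i) ^ 2 = (∑ i, (N i) ^ 2) / W ^ 2 := by
        rw [Finset.sum_div]
        refine Finset.sum_congr rfl fun i _ => ?_
        rw [hm, div_pow]
      rw [this, div_le_one (by positivity)]
      exact hN
    have hK := Literature.Probability.FitznerVanDerHofstad2017.WeightSplitCrossTerm.crossKernel r₀ r₁ m hm1
    have hNm : ∀ i, N i = W * m i := fun i => by rw [hm]; field_simp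
    have hlhs : (1 / 2 : ℝ) * ∑ i, N i * ((r₁ i - r₀ i : ℤ) : ℝ) = W * ((1 / 2 : ℝ) * ∑ i, m i * ((r₁ i - r₀ i : ℤ) : ℝ)) := by
      rw [Finset.mul_sum, Finset.mul_sum, Finset.mul_sum]
      refine Finset.sum_congr rfl fun i _ => ?_
      rw [hNm i]; ring
    rw [hlhs]
    have := mul_le_mul_of_nonneg_left hK hW
    linarith [this]

end Summit.CriticalPhenomena.LaceExpansionHighD.WeightSplit

end
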